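import Literature.Analysis.SpecialFunctions.SpheroidalHarmonicSpectral
import HarnessLib

/-!
# Barrier catalogue `FinalStateConjecture`: Shlapentokh-Rothman's unstable Klein–Gordon modes —
# the angular input `Im((λ + a²ω²) ω̄) < 0` of the superradiance argument (Prop. B.2)
(`Literature/Barriers/FinalStateConjecture/`, D-0021, D-0014; family `gr`; namespace
`Literature.Barriers.FinalStateConjecture`)

Shlapentokh-Rothman, Comm. Math. Phys. 329 (2014), Prop. B.2 (= Prop. 8.2 of the held copy):
"`ω_I > 0 ⇒ Im((λ + a²ω²)ω̄) < 0`", the angular inequality invoked in the proof of Prop. 4.6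
(superradiance of the unstable modes; here `superradiant_of_isRadialSolution`,
`KleinGordonRadialCurrent.lean`, hypothesis `hΛ`). This file derives it for the eigen-triples of
the tree — a zero `ν` of the spheroidal shooting function at spheroidicity `κ = a²(ω² − μ²)`
(`sphmDer m₀ ν κ 1 = 0`, `λ = ν + m₀(m₀ + 1)`, `m₀ = |m| ≥ 1`) — from the spectral identity of
`SpheroidalHarmonicSpectral.lean` (`exists_tau_spectral`: `Im ν = −τ Im κ`, `Re ν ≥ −τ Re κ`,
`0 < τ < 1`), under the smallness condition `a²|ω|² ≤ m₀(m₀ + 1)`: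

`Im((λ + a²ω²)ω̄) ≤ ε[(1 − τ)a²|ω|² − τa²μ² − m₀(m₀+1)] ≤ −ετ(m₀(m₀+1) + a²μ²) < 0` (`ε = Im ω`).

Scope note. The printed proof of Prop. B.2 displays the identity with `+a²|ω|² sin²θ`; the correct
sign of that term is `−` (multiply `−a²ω² sin²θ · S` by `ω̄ S̄`: `−a²|ω|²ω sin²θ|S|²`), so the printed
conclusion needs `a²|ω|² ≲ m²`; in the regime of Thm. 1.2 (`|ω| ≈ |am|/(2Mr₊)`, `a² < Mr₊`) one has
`a²|ω|² < m²/4 ≤ m₀(m₀+1)`, which is the hypothesis used here. Everything is proved.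

## References

* Y. Shlapentokh-Rothman, Comm. Math. Phys. 329 (2014) 859–891, arXiv:1302.3448: App. B
  Prop. B.2 (held copy `paper:arxiv-1302.3448`, p. 17), §4.4 Prop. 4.6 (p. 12).
  Key `ShlapentokhRothman2014KleinGordon`.
-/

noncomputable section

open scoped ComplexConjugate

namespace Literature.Barriers.FinalStateConjecture

open Literature.Analysis.SpecialFunctions

/-- **Prop. B.2 for the tree's eigen-triples.** Let `m₀ ≥ 1`, `Im ω > 0`, `a²‖ω‖² ≤ m₀(m₀+1)`, and
let `ν` be a zero of the spheroidal shooting function at `κ = a²(ω² − μ²)`. Then, with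
`λ = ν + m₀(m₀+1)`, `Im((λ + a²ω²) ω̄) < 0`.
[cite: ShlapentokhRothman2014KleinGordon, Prop. B.2] -/
theorem im_angular_mul_conj_neg {m₀ : ℕ} (hm₀ : 1 ≤ m₀) {ν w : ℂ} {a μ : ℝ}
    (hg : sphmDer m₀ ν (((a ^ 2 : ℝ) : ℂ) * (w ^ 2 - ((μ ^ 2 : ℝ) : ℂ))) 1 = 0)
    (hw : 0 < w.im) (hsmall : a ^ 2 * ‖w‖ ^ 2 ≤ (m₀ : ℝ) * ((m₀ : ℝ) + 1)) :
    ((ν + (m₀ : ℂ) * ((m₀ : ℂ) + 1) + ((a ^ 2 : ℝ) : ℂ) * w ^ 2) * conj w).im < 0 := by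
  obtain ⟨τ, hτ0, hτ1, him, hre⟩ := exists_tau_spectral hg
  -- real and imaginary parts of `κ = a²(ω² − μ²)`
  have hκim : (((a ^ 2 : ℝ) : ℂ) * (w ^ 2 - ((μ ^ 2 : ℝ) : ℂ))).im = a ^ 2 * (2 * w.re * w.im) := by
    simp only [pow_two, Complex.mul_im, Complex.mul_re, Complex.sub_re, Complex.sub_im,
      Complex.ofReal_re, Complex.ofReal_im, zero_mul, add_zero, sub_zero]
    ring
  have hκre : (((a ^ 2 : ℝ) : ℂ) * (w ^ 2 - ((μ ^ 2 : ℝ) : ℂ))).re =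
      a ^ 2 * (w.re ^ 2 - w.im ^ 2 - μ ^ 2) := by
    simp only [pow_two, Complex.mul_re, Complex.mul_im, Complex.sub_re, Complex.sub_im,
      Complex.ofReal_re, Complex.ofReal_im, zero_mul, sub_zero]
  rw [hκim] at him
  rw [hκre] at hre
  -- the imaginary part in question, expanded
  have hnorm : ‖w‖ ^ 2 = w.re ^ 2 + w.im ^ 2 := by
    rw [Complex.sq_norm, Complex.normSq_apply]; ring
  have hX : ((ν + (m₀ : ℂ) * ((m₀ : ℂ) + 1) + ((a ^ 2 : ℝ) : ℂ) * w ^ 2) * conj w).im =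
      ν.im * w.re - ν.re * w.im - (m₀ : ℝ) * ((m₀ : ℝ) + 1) * w.im +
        a ^ 2 * (w.re ^ 2 + w.im ^ 2) * w.im := by
    simp only [pow_two, Complex.mul_im, Complex.mul_re, Complex.add_re, Complex.add_im,
      Complex.conj_re, Complex.conj_im, Complex.ofReal_re, Complex.ofReal_im, Complex.natCast_re,
      Complex.natCast_im, Complex.one_re, Complex.one_im, zero_mul, mul_zero, add_zero, sub_zero]
    ring
  rw [hX, him]
  set ε : ℝ := w.im with hε
  set x : ℝ := w.re with hx
  set K : ℝ := (m₀ : ℝ) * ((m₀ : ℝ) + 1) with hK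
  -- `−ν.re ε ≤ τ a²(x² − ε² − μ²) ε`
  have h1 : -ν.re * ε ≤ τ * (a ^ 2 * (x ^ 2 - ε ^ 2 - μ ^ 2)) * ε := by
    have : -ν.re ≤ τ * (a ^ 2 * (x ^ 2 - ε ^ 2 - μ ^ 2)) := by linarith
    exact mul_le_mul_of_nonneg_right this hw.le
  have hm : (1 : ℝ) ≤ (m₀ : ℝ) := by exact_mod_cast hm₀
  have hK2 : 2 ≤ K := by rw [hK]; nlinarith
  rw [hnorm] at hsmall
  -- the upper bound `ε[(1 − τ) a²|ω|² − τ a² μ² − K] ≤ −2τε`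
  have h2 : -τ * (a ^ 2 * (2 * x * ε)) * x + τ * (a ^ 2 * (x ^ 2 - ε ^ 2 - μ ^ 2)) * ε - K * ε +
      a ^ 2 * (x ^ 2 + ε ^ 2) * ε =
      ε * ((1 - τ) * (a ^ 2 * (x ^ 2 + ε ^ 2)) - τ * a ^ 2 * μ ^ 2 - K) := by ring
  have h3 : (1 - τ) * (a ^ 2 * (x ^ 2 + ε ^ 2)) ≤ (1 - τ) * K :=
    mul_le_mul_of_nonneg_left hsmall (by linarith)
  have h4 : (1 - τ) * (a ^ 2 * (x ^ 2 + ε ^ 2)) - τ * a ^ 2 * μ ^ 2 - K ≤ -(2 * τ) := by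
    have : 0 ≤ τ * a ^ 2 * μ ^ 2 := by positivity
    nlinarith
  have h5 : ε * ((1 - τ) * (a ^ 2 * (x ^ 2 + ε ^ 2)) - τ * a ^ 2 * μ ^ 2 - K) ≤ ε * (-(2 * τ)) :=
    mul_le_mul_of_nonneg_left h4 hw.le
  have h6 : 0 < ε * τ := mul_pos hw hτ0
  linarith

end Literature.Barriers.FinalStateConjecture

end
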